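import Summits.QuantumFields.YangMills.Theorems.UnitScaleGibbsMGFGronwall
import Summits.QuantumFields.YangMills.Theorems.UnitScaleGibbsMGFSecondMoment
import HarnessLib

/-!
# Gaussian domination from a black-box Schwinger–Dyson identity with a TWO-LEVEL Hessian bound (on-event `K_G`, off-event `K`):
# `∫ e^{tX} dμ ≤ exp((K_G + K e^{|t|B} μ(Gᶜ)) t²∕(2c))` and `∫ X² dμ ≤ (K_G + K·μ(Gᶜ)) ∕ c`

Crux of record `UnitScaleTilt.HistoryTailL` (stmt-QuantumFields-19936), cell `ym3-torus` (YM ladder rung R3 = continuum SU(2) Yang–Mills on T³ — a RUNG, NOT the Clay problem);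
width seat `ym3-torus-px17` gen 7.  Pure real analysis ∕ measure theory (Mathlib + ✓ `UnitScaleGibbsMGFGronwall` (α) + ✓ `UnitScaleGibbsMGFSecondMoment` (β) only), the
«assembly» row of LINE 28's CONSTRUCTION C3 (`Cruxes/HistoryTailL/GrossTransferAnnex4.md` §0∕§6, ideator ym-r3-idea-2 g15): once SOME integration-by-parts argument — fixed
directions (✓ `UnitScaleGibbsSchwingerDysonGaussianDomination.schwingerDyson_identity`), adapted directions (px8 g9 «SD-AD»), or the tree-conditional identity of C3 — has
produced, for a bounded centred observable `X` and a bounded `Y` («`∂_u X`») on a probability space, the BLACK-BOX identity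

  `c · ∫ X e^{sX} dμ = s · ∫ Y e^{sX} dμ`   for every real `s`   (`c > 0`; for Bałaban's `gibbsK`, `c = β_K`),

and the Hessian-type observable `Y` obeys a TWO-LEVEL bound — `|Y| ≤ K_G` on a measurable «good event» `G` (the on-event bound (A) of annex 4) and `|Y| ≤ K` everywhere
(the crude global constant, e.g. ✓∕⧗ `UnitScaleGibbsActionDerivativeGaussianDomination.abs_actionDeriv₂_le`) — then Gross's Grönwall step goes through with the off-event
mass entering ADDITIVELY:

* §1 `nonempty_of_isProbabilityMeasure`, ★ `one_le_integral_exp_mul` (`1 ≤ ∫ e^{sX}` from `∫ X = 0` and `1 + y ≤ e^y` — the elementary Jensen that lets the off-event term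
  ride on `ψ`), ★ `integral_mul_exp_mul_le_twoLevel` (`∫ Y e^{sX} ≤ K_G ∫ e^{sX} + K e^{|s|B} μ(Gᶜ)`);
* §2 ★★★ `integral_exp_mul_le_of_sd_twoLevel` — `∫ e^{tX} dμ ≤ exp((K_G + K·e^{|t|B}·δ)·t²∕(2c))` for every real `t` (`μ(Gᶜ) ≤ δ`; ✓(α) `le_mul_exp_of_deriv_le_linear_mul`);
* §3 ★★★ `integral_sq_le_of_sd_twoLevel` — `∫ X² dμ ≤ (K_G + K·δ) ∕ c` (✓(β) `integral_sq_mul_weight_le_of_subgaussian_mgf_nhds` on `(0, T]`, then `T → 0⁺` removes `e^{TB}`):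
  THE SHAPE OF ANNEX 4 §6 «assembly» — `E Y² ≤ (on-event constant + K·P(Gᶜ)) ∕ β_K`, no smooth cut-off, no `χ′` term.

HONEST SCOPE.  Generic letters; the identity `hSD`, the on-event bound and the event mass are HYPOTHESES (in LINE 28 they are `stub_condSD`, `stub_hessOnEvent` = (A2)+(A3′),
`stub_peierls0`); nothing of «ShallowFluxSecondMomentL», «BlockSecondMomentL», (Q), K1, `MeanDeviationL`, `HistoryTailL`, R3, d = 4, a continuum limit or a mass gap is proved;
LINE 28 is an idea, not a registered line; the Yang–Mills mass gap is NOT proved.  THEOREMS ONLY (0 `def`, 0 `sorry`); `--supports stmt-QuantumFields-19936 --as helper`.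

References: L. Gross, CMP 92 (1983) 137–162, Thm 2.2 and its proof [GrossCMP1983]; S. Boucheron, G. Lugosi, P. Massart, Concentration Inequalities (2013) §2.2–§2.3
[BoucheronLugosiMassart2013].
-/

set_option autoImplicit false

noncomputable section

open MeasureTheory Set Filter Topology
open Summit.QuantumFields.YangMills.Theorems.UnitScaleGibbsMGFGronwall
  (le_mul_exp_of_deriv_le_linear_mul hasDerivAt_integral_exp_mul_weight integral_exp_mul_weight_pos)
open Summit.QuantumFields.YangMills.Theorems.UnitScaleGibbsMGFSecondMoment (integrable_of_abs_le integral_sq_mul_weight_le_of_subgaussian_mgf_nhds)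

namespace Summit.QuantumFields.YangMills.Theorems.UnitScaleGibbsMGFTwoLevelDomination

variable {Ω : Type*} [MeasurableSpace Ω] (μ : Measure Ω) [IsProbabilityMeasure μ]

/-! ## §1 Letters -/

include μ in
/-- A probability space is nonempty. [folklore] -/
theorem nonempty_of_isProbabilityMeasure : Nonempty Ω := by
  by_contra h
  rw [not_nonempty_iff] at h
  have h1 : μ Set.univ = 1 := measure_univ
  rw [Set.univ_eq_empty_iff.mpr h, measure_empty] at h1
  exact zero_ne_one h1

/-- ★ **THE ELEMENTARY JENSEN STEP**: for a bounded measurable centred `X` (`∫ X dμ = 0`), `1 ≤ ∫ e^{sX} dμ` for every real `s` (integrate `1 + sX ≤ e^{sX}`).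
[cite: BoucheronLugosiMassart2013, §2.2] -/
theorem one_le_integral_exp_mul {X : Ω → ℝ} (hXm : Measurable X) {B : ℝ} (hXB : ∀ ω, |X ω| ≤ B) (hX0 : ∫ ω, X ω ∂μ = 0) (s : ℝ) :
    1 ≤ ∫ ω, Real.exp (s * X ω) ∂μ := by
  have hiX : Integrable X μ := integrable_of_abs_le μ hXm hXB
  have hiE : Integrable (fun ω => Real.exp (s * X ω)) μ := by
    refine integrable_of_abs_le μ (measurable_const.mul hXm).exp (C := Real.exp (|s| * B)) fun ω => ?_
    rw [abs_of_pos (Real.exp_pos _)]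
    refine Real.exp_le_exp.2 ?_
    calc s * X ω ≤ |s * X ω| := le_abs_self _
      _ = |s| * |X ω| := abs_mul _ _
      _ ≤ |s| * B := mul_le_mul_of_nonneg_left (hXB ω) (abs_nonneg _)
  calc (1 : ℝ) = ∫ ω, (1 + s * X ω) ∂μ := by
        rw [integral_add (integrable_const _) (hiX.const_mul s), integral_const, integral_const_mul, hX0]
        simp
    _ ≤ ∫ ω, Real.exp (s * X ω) ∂μ := integral_mono ((integrable_const _).add (hiX.const_mul s)) hiE fun ω => by
        have := Real.add_one_le_exp (s * X ω); linarith

/-- ★ **THE TWO-LEVEL SPLIT**: if `|Y| ≤ K_G` on the measurable event `G` (`K_G ≥ 0`) and `|Y| ≤ K` everywhere (`K ≥ 0`), `|X| ≤ B`, then for every real `s`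
`∫ Y e^{sX} dμ ≤ K_G·∫ e^{sX} dμ + K·e^{|s|B}·μ(Gᶜ)`. [cite: GrossCMP1983, Thm 2.2 (proof)] -/
theorem integral_mul_exp_mul_le_twoLevel {X Y : Ω → ℝ} (hXm : Measurable X) (hYm : Measurable Y) {B K KG : ℝ} (hXB : ∀ ω, |X ω| ≤ B)
    (hYK : ∀ ω, |Y ω| ≤ K) (hK : 0 ≤ K) {G : Set Ω} (hG : MeasurableSet G) (hYG : ∀ ω ∈ G, |Y ω| ≤ KG) (hKG : 0 ≤ KG) (s : ℝ) :
    ∫ ω, Y ω * Real.exp (s * X ω) ∂μ ≤ KG * ∫ ω, Real.exp (s * X ω) ∂μ + K * Real.exp (|s| * B) * μ.real Gᶜ := by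
  have hexp_le : ∀ ω, Real.exp (s * X ω) ≤ Real.exp (|s| * B) := fun ω => by
    refine Real.exp_le_exp.2 ?_
    calc s * X ω ≤ |s * X ω| := le_abs_self _
      _ = |s| * |X ω| := abs_mul _ _
      _ ≤ |s| * B := mul_le_mul_of_nonneg_left (hXB ω) (abs_nonneg _)
  have hiE : Integrable (fun ω => Real.exp (s * X ω)) μ :=
    integrable_of_abs_le μ (measurable_const.mul hXm).exp (C := Real.exp (|s| * B)) fun ω => by
      rw [abs_of_pos (Real.exp_pos _)]; exact hexp_le ω
  have hiYE : Integrable (fun ω => Y ω * Real.exp (s * X ω)) μ :=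
    integrable_of_abs_le μ (hYm.mul (measurable_const.mul hXm).exp) (C := K * Real.exp (|s| * B)) fun ω => by
      rw [abs_mul, abs_of_pos (Real.exp_pos _)]
      exact mul_le_mul (hYK ω) (hexp_le ω) (Real.exp_pos _).le hK
  have hiI : Integrable (Gᶜ.indicator fun _ : Ω => K * Real.exp (|s| * B)) μ := (integrable_const _).indicator hG.compl
  -- pointwise two-level bound
  have hpt : ∀ ω, Y ω * Real.exp (s * X ω) ≤ KG * Real.exp (s * X ω) + Gᶜ.indicator (fun _ : Ω => K * Real.exp (|s| * B)) ω := by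
    intro ω
    by_cases hω : ω ∈ G
    · have h1 : Gᶜ.indicator (fun _ : Ω => K * Real.exp (|s| * B)) ω = 0 :=
        indicator_of_notMem (fun h => (Set.mem_compl_iff G ω).mp h hω) _
      rw [h1, add_zero]
      exact mul_le_mul_of_nonneg_right ((le_abs_self _).trans (hYG ω hω)) (Real.exp_pos _).le
    · have h1 : Gᶜ.indicator (fun _ : Ω => K * Real.exp (|s| * B)) ω = K * Real.exp (|s| * B) := indicator_of_mem (Set.mem_compl hω) _
      rw [h1]
      have h2 : Y ω * Real.exp (s * X ω) ≤ K * Real.exp (|s| * B) :=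
        (le_abs_self _).trans (by rw [abs_mul, abs_of_pos (Real.exp_pos _)]; exact mul_le_mul (hYK ω) (hexp_le ω) (Real.exp_pos _).le hK)
      have h3 : 0 ≤ KG * Real.exp (s * X ω) := mul_nonneg hKG (Real.exp_pos _).le
      linarith
  calc ∫ ω, Y ω * Real.exp (s * X ω) ∂μ
      ≤ ∫ ω, (KG * Real.exp (s * X ω) + Gᶜ.indicator (fun _ : Ω => K * Real.exp (|s| * B)) ω) ∂μ :=
        integral_mono hiYE ((hiE.const_mul KG).add hiI) hpt
    _ = KG * ∫ ω, Real.exp (s * X ω) ∂μ + K * Real.exp (|s| * B) * μ.real Gᶜ := by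
        rw [integral_add (hiE.const_mul KG) hiI, integral_const_mul, integral_indicator_const _ hG.compl, smul_eq_mul]
        ring

/-! ## §2 Gaussian domination from the black-box identity -/

/-- Gaussian domination for `t ≥ 0`. [cite: GrossCMP1983, Thm 2.2 (proof)] -/
theorem integral_exp_mul_le_of_sd_twoLevel_of_nonneg {X Y : Ω → ℝ} (hXm : Measurable X) (hYm : Measurable Y) {B K KG : ℝ}
    (hXB : ∀ ω, |X ω| ≤ B) (hYK : ∀ ω, |Y ω| ≤ K) (hK : 0 ≤ K) {G : Set Ω} (hG : MeasurableSet G) (hYG : ∀ ω ∈ G, |Y ω| ≤ KG) (hKG : 0 ≤ KG)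
    {δ : ℝ} (hδ : μ.real Gᶜ ≤ δ) (hX0 : ∫ ω, X ω ∂μ = 0) {c : ℝ} (hc : 0 < c)
    (hSD : ∀ s : ℝ, c * ∫ ω, X ω * Real.exp (s * X ω) ∂μ = s * ∫ ω, Y ω * Real.exp (s * X ω) ∂μ) {t : ℝ} (ht : 0 ≤ t) :
    ∫ ω, Real.exp (t * X ω) ∂μ ≤ Real.exp ((KG + K * Real.exp (|t| * B) * δ) * t ^ 2 / (2 * c)) := by
  obtain ⟨ω₀⟩ := nonempty_of_isProbabilityMeasure μ
  have hB0 : 0 ≤ B := (abs_nonneg _).trans (hXB ω₀)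
  have hδ0 : 0 ≤ δ := measureReal_nonneg.trans hδ
  -- the MGF with the trivial weight
  have hχm : Measurable (fun _ : Ω => (1 : ℝ)) := measurable_const
  have hχM : ∀ ω : Ω, |(fun _ : Ω => (1 : ℝ)) ω| ≤ 1 := fun _ => by simp
  have hχ0 : ∀ ω : Ω, 0 ≤ (fun _ : Ω => (1 : ℝ)) ω := fun _ => zero_le_one
  have hmass : 0 < ∫ ω, (fun _ : Ω => (1 : ℝ)) ω ∂μ := by simp
  set a : ℝ := (KG + K * Real.exp (|t| * B) * δ) / c with ha
  have hgron := le_mul_exp_of_deriv_le_linear_mul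
    (ψ := fun r => ∫ ω, Real.exp (r * X ω) * (fun _ : Ω => (1 : ℝ)) ω ∂μ)
    (ψ' := fun r => ∫ ω, X ω * Real.exp (r * X ω) * (fun _ : Ω => (1 : ℝ)) ω ∂μ) (a := a) (Δ := 0) ht
    (fun r _ => hasDerivAt_integral_exp_mul_weight μ hXm hχm hXB hχM r)
    (fun r _ => integral_exp_mul_weight_pos μ hXm hχm hXB hχM hχ0 hmass r)
    (fun r hr => by
      simp only [mul_one, add_zero]
      -- `ψ′(r) = (r/c) ∫ Y e^{rX} ≤ (r/c)(K_G ψ(r) + K e^{rB} μ(Gᶜ)) ≤ a·r·ψ(r)`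
      have hid : ∫ ω, X ω * Real.exp (r * X ω) ∂μ = (r / c) * ∫ ω, Y ω * Real.exp (r * X ω) ∂μ := by
        rw [div_mul_eq_mul_div, eq_div_iff hc.ne', mul_comm _ c]
        exact hSD r
      have hsplit := integral_mul_exp_mul_le_twoLevel μ hXm hYm hXB hYK hK hG hYG hKG r
      have hψ1 : 1 ≤ ∫ ω, Real.exp (r * X ω) ∂μ := one_le_integral_exp_mul μ hXm hXB hX0 r
      have hrB : Real.exp (|r| * B) ≤ Real.exp (|t| * B) := by
        refine Real.exp_le_exp.2 (mul_le_mul_of_nonneg_right ?_ hB0)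
        rw [abs_of_nonneg hr.1, abs_of_nonneg ht]; exact hr.2
      have hoff : K * Real.exp (|r| * B) * μ.real Gᶜ ≤ K * Real.exp (|t| * B) * δ * ∫ ω, Real.exp (r * X ω) ∂μ := by
        calc K * Real.exp (|r| * B) * μ.real Gᶜ ≤ K * Real.exp (|t| * B) * δ := by
              have := measureReal_nonneg (μ := μ) (s := Gᶜ)
              gcongr
          _ = K * Real.exp (|t| * B) * δ * 1 := (mul_one _).symm
          _ ≤ K * Real.exp (|t| * B) * δ * ∫ ω, Real.exp (r * X ω) ∂μ :=
              mul_le_mul_of_nonneg_left hψ1 (by positivity)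
      have hY : ∫ ω, Y ω * Real.exp (r * X ω) ∂μ ≤ (KG + K * Real.exp (|t| * B) * δ) * ∫ ω, Real.exp (r * X ω) ∂μ := by
        calc ∫ ω, Y ω * Real.exp (r * X ω) ∂μ ≤ KG * ∫ ω, Real.exp (r * X ω) ∂μ + K * Real.exp (|r| * B) * μ.real Gᶜ := hsplit
          _ ≤ KG * ∫ ω, Real.exp (r * X ω) ∂μ + K * Real.exp (|t| * B) * δ * ∫ ω, Real.exp (r * X ω) ∂μ := by linarith
          _ = (KG + K * Real.exp (|t| * B) * δ) * ∫ ω, Real.exp (r * X ω) ∂μ := by ring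
      rw [hid]
      have hr0 : 0 ≤ r / c := div_nonneg hr.1 hc.le
      calc r / c * ∫ ω, Y ω * Real.exp (r * X ω) ∂μ ≤ r / c * ((KG + K * Real.exp (|t| * B) * δ) * ∫ ω, Real.exp (r * X ω) ∂μ) :=
            mul_le_mul_of_nonneg_left hY hr0
        _ = a * r * ∫ ω, Real.exp (r * X ω) ∂μ := by rw [ha]; ring)
  simp only [mul_one, zero_mul, Real.exp_zero, integral_const, probReal_univ, smul_eq_mul, one_mul, add_zero] at hgron
  calc ∫ ω, Real.exp (t * X ω) ∂μ ≤ Real.exp (a * t ^ 2 / 2) := hgron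
    _ = Real.exp ((KG + K * Real.exp (|t| * B) * δ) * t ^ 2 / (2 * c)) := by rw [ha]; congr 1; field_simp

/-- ★★★ **GAUSSIAN DOMINATION FROM A BLACK-BOX SCHWINGER–DYSON IDENTITY WITH A TWO-LEVEL HESSIAN BOUND.**  On a probability space let `X` (`|X| ≤ B`, `∫ X dμ = 0`) and `Y`
(`|Y| ≤ K` everywhere, `|Y| ≤ K_G` on a measurable event `G` with `μ(Gᶜ) ≤ δ`; `K, K_G ≥ 0`) be measurable with `c·∫ X e^{sX} dμ = s·∫ Y e^{sX} dμ` for every real `s` (`c > 0`).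
Then for EVERY real `t`: `∫ e^{tX} dμ ≤ exp((K_G + K·e^{|t|B}·δ)·t²∕(2c))` — the on-event constant drives the Gaussian rate, the off-event mass enters additively (it rides on `ψ ≥ 1`).
`t ≤ 0` by the symmetry `(X, Y) ↦ (−X, Y)` of the hypotheses. [cite: GrossCMP1983, Thm 2.2] -/
theorem integral_exp_mul_le_of_sd_twoLevel {X Y : Ω → ℝ} (hXm : Measurable X) (hYm : Measurable Y) {B K KG : ℝ}
    (hXB : ∀ ω, |X ω| ≤ B) (hYK : ∀ ω, |Y ω| ≤ K) (hK : 0 ≤ K) {G : Set Ω} (hG : MeasurableSet G) (hYG : ∀ ω ∈ G, |Y ω| ≤ KG) (hKG : 0 ≤ KG)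
    {δ : ℝ} (hδ : μ.real Gᶜ ≤ δ) (hX0 : ∫ ω, X ω ∂μ = 0) {c : ℝ} (hc : 0 < c)
    (hSD : ∀ s : ℝ, c * ∫ ω, X ω * Real.exp (s * X ω) ∂μ = s * ∫ ω, Y ω * Real.exp (s * X ω) ∂μ) (t : ℝ) :
    ∫ ω, Real.exp (t * X ω) ∂μ ≤ Real.exp ((KG + K * Real.exp (|t| * B) * δ) * t ^ 2 / (2 * c)) := by
  rcases le_or_gt 0 t with ht | ht
  · exact integral_exp_mul_le_of_sd_twoLevel_of_nonneg μ hXm hYm hXB hYK hK hG hYG hKG hδ hX0 hc hSD ht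
  · -- apply the nonnegative case to `(-X, Y)` at `-t`
    have hXm' : Measurable (fun ω => -X ω) := hXm.neg
    have hXB' : ∀ ω, |(fun ω => -X ω) ω| ≤ B := fun ω => by simp only [abs_neg]; exact hXB ω
    have hX0' : ∫ ω, (fun ω => -X ω) ω ∂μ = 0 := by simp only [integral_neg, hX0, neg_zero]
    have hSD' : ∀ s : ℝ, c * ∫ ω, (fun ω => -X ω) ω * Real.exp (s * (fun ω => -X ω) ω) ∂μ =
        s * ∫ ω, Y ω * Real.exp (s * (fun ω => -X ω) ω) ∂μ := by
      intro s
      have h := hSD (-s)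
      have h1 : ∀ ω, (-s) * X ω = s * (-X ω) := fun ω => by ring
      simp only [h1] at h
      have h2 : ∫ ω, -X ω * Real.exp (s * -X ω) ∂μ = -∫ ω, X ω * Real.exp (s * -X ω) ∂μ := by
        rw [← integral_neg]; refine integral_congr_ae (ae_of_all _ fun ω => ?_); ring
      show c * ∫ ω, -X ω * Real.exp (s * -X ω) ∂μ = s * ∫ ω, Y ω * Real.exp (s * -X ω) ∂μ
      rw [h2, mul_neg, h]
      ring
    have h := integral_exp_mul_le_of_sd_twoLevel_of_nonneg μ hXm' hYm hXB' hYK hK hG hYG hKG hδ hX0' hc hSD' (t := -t) (by linarith)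
    have he : ∀ ω, Real.exp (-t * (fun ω => -X ω) ω) = Real.exp (t * X ω) := fun ω => by simp only [neg_mul_neg]
    simp only [he, abs_neg, neg_sq] at h
    exact h

/-! ## §3 The variance bound: `∫ X² dμ ≤ (K_G + K·δ) ∕ c` -/

/-- ★★★ **THE VARIANCE FROM THE TWO-LEVEL DOMINATION**: under the hypotheses of `integral_exp_mul_le_of_sd_twoLevel`, `∫ X² dμ ≤ (K_G + K·δ) ∕ c` — for every `T ∈ (0,1]`
the domination on `(0,T]` gives `∫ X² ≤ (K_G + K e^{TB} δ)∕c` (✓(β) `integral_sq_mul_weight_le_of_subgaussian_mgf_nhds`), and `T → 0⁺`.  This is the shape of LINE 28 annex 4 §6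
«assembly»: `E X² ≤ (on-event constant + K·P(Gᶜ)) ∕ β_K`. [cite: GrossCMP1983, Thm 2.2; BoucheronLugosiMassart2013, §2.3] -/
theorem integral_sq_le_of_sd_twoLevel {X Y : Ω → ℝ} (hXm : Measurable X) (hYm : Measurable Y) {B K KG : ℝ}
    (hXB : ∀ ω, |X ω| ≤ B) (hYK : ∀ ω, |Y ω| ≤ K) (hK : 0 ≤ K) {G : Set Ω} (hG : MeasurableSet G) (hYG : ∀ ω ∈ G, |Y ω| ≤ KG) (hKG : 0 ≤ KG)
    {δ : ℝ} (hδ : μ.real Gᶜ ≤ δ) (hX0 : ∫ ω, X ω ∂μ = 0) {c : ℝ} (hc : 0 < c)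
    (hSD : ∀ s : ℝ, c * ∫ ω, X ω * Real.exp (s * X ω) ∂μ = s * ∫ ω, Y ω * Real.exp (s * X ω) ∂μ) :
    ∫ ω, X ω ^ 2 ∂μ ≤ (KG + K * δ) / c := by
  obtain ⟨ω₀⟩ := nonempty_of_isProbabilityMeasure μ
  have hB0 : 0 ≤ B := (abs_nonneg _).trans (hXB ω₀)
  have hδ0 : 0 ≤ δ := measureReal_nonneg.trans hδ
  have hmgf := integral_exp_mul_le_of_sd_twoLevel μ hXm hYm hXB hYK hK hG hYG hKG hδ hX0 hc hSD
  -- for every `T ∈ (0, 1]`: `∫ X² ≤ (K_G + K e^{TB} δ)/c`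
  have hT : ∀ T : ℝ, 0 < T → ∫ ω, X ω ^ 2 ∂μ ≤ (KG + K * Real.exp (T * B) * δ) / c := by
    intro T hT0
    have haT : 0 ≤ (KG + K * Real.exp (T * B) * δ) / c := div_nonneg (by positivity) hc.le
    have hbound : ∀ t ∈ Ioc (0 : ℝ) T, ∀ σ : ℝ, (σ = t ∨ σ = -t) →
        ∫ ω, Real.exp (σ * X ω) ∂μ ≤ Real.exp ((KG + K * Real.exp (T * B) * δ) / c * t ^ 2 / 2) := by
      intro t ht σ hσ
      have hσt : |σ| = t := by
        rcases hσ with h | h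
        · rw [h, abs_of_pos ht.1]
        · rw [h, abs_neg, abs_of_pos ht.1]
      have hσ2 : σ ^ 2 = t ^ 2 := by rcases hσ with h | h <;> simp [h]
      calc ∫ ω, Real.exp (σ * X ω) ∂μ ≤ Real.exp ((KG + K * Real.exp (|σ| * B) * δ) * σ ^ 2 / (2 * c)) := hmgf σ
        _ ≤ Real.exp ((KG + K * Real.exp (T * B) * δ) / c * t ^ 2 / 2) := by
            rw [hσt, hσ2]
            refine Real.exp_le_exp.2 ?_
            have hTB : Real.exp (t * B) ≤ Real.exp (T * B) := Real.exp_le_exp.2 (mul_le_mul_of_nonneg_right ht.2 hB0)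
            have h1 : (KG + K * Real.exp (t * B) * δ) * t ^ 2 / (2 * c) = (KG + K * Real.exp (t * B) * δ) / c * t ^ 2 / 2 := by
              field_simp
            rw [h1]
            have : 0 ≤ t ^ 2 / 2 / c := by positivity
            have h2 : (KG + K * Real.exp (t * B) * δ) / c * t ^ 2 / 2 = (KG + K * Real.exp (t * B) * δ) * (t ^ 2 / 2 / c) := by
              field_simp
            have h3 : (KG + K * Real.exp (T * B) * δ) / c * t ^ 2 / 2 = (KG + K * Real.exp (T * B) * δ) * (t ^ 2 / 2 / c) := by
              field_simp
            rw [h2, h3]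
            gcongr
    have h := integral_sq_mul_weight_le_of_subgaussian_mgf_nhds μ hXm measurable_const hXB (χ := fun _ => (1 : ℝ)) (M := 1)
      (fun _ => zero_le_one) (fun _ => le_rfl) hT0 haT
      (fun t ht => by
        simp only [mul_one, integral_const, probReal_univ, smul_eq_mul, one_mul]
        exact hbound t ht t (Or.inl rfl))
      (fun t ht => by
        simp only [mul_one, integral_const, probReal_univ, smul_eq_mul, one_mul]
        exact hbound t ht (-t) (Or.inr rfl))
    simpa using h
  -- let `T → 0⁺`
  have hcont : Tendsto (fun T : ℝ => (KG + K * Real.exp (T * B) * δ) / c) (𝓝[>] 0) (𝓝 ((KG + K * δ) / c)) := by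
    have hc' : Continuous fun T : ℝ => (KG + K * Real.exp (T * B) * δ) / c := by continuity
    have h0 : (fun T : ℝ => (KG + K * Real.exp (T * B) * δ) / c) 0 = (KG + K * δ) / c := by simp
    exact (hc'.tendsto' 0 _ h0).mono_left nhdsWithin_le_nhds
  have hev : ∀ᶠ T in 𝓝[>] (0 : ℝ), ∫ ω, X ω ^ 2 ∂μ ≤ (KG + K * Real.exp (T * B) * δ) / c :=
    eventually_nhdsWithin_of_forall fun T hT0 => hT T hT0
  exact ge_of_tendsto hcont hev

end Summit.QuantumFields.YangMills.Theorems.UnitScaleGibbsMGFTwoLevelDomination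

end
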